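import Mathlib.Combinatorics.SimpleGraph.Acyclic
import Summits.CriticalPhenomena.PercolationContinuityZ3.Theorems.PercNearOneGluingNoHeavyLowerTailAPLConjFForest
import HarnessLib

/-!
# `NoHeavyLowerTail` (stmt-CriticalPhenomena-4575) — THEOREM F_T for bond percolation: CONJECTURE F, Harris and APL-G on weighted graphs whose edges avoiding `b, c` form a forest

Support file (prover prim-ineq-gen-8 gen 36; `--supports stmt-CriticalPhenomena-4575`; memo
run/shared/lean/prim/prim-ineq-gen-8/FINDING-gen36-LEMMA-U.md §5).  No definitions, no named facts, no sorries.

The probabilistic reading of `conjF_forest` (`…APLConjFForest.lean`).  `μ = prodBernoulli w` on the pairs of a finite vertex type `V`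
(each pair `e` open with probability `w e`, independently), distinct vertices `a, b, c`, and the five connection cells
`u0 = μ(a|b|c)`, `uab = μ(ab|c)`, `uac = μ(ac|b)`, `ubc = μ(a|bc)`, `u3 = μ(a ↔ b, a ↔ c)` (events `openConn`).
HYPOTHESIS: the graph of the positive-weight (non-loop) pairs avoiding `b` and `c` is ACYCLIC (`SimpleGraph.IsAcyclic`) — "`G ∖ {b,c}` is a
forest", `G` the support graph of `w`.
CONCLUSION (`conjF_forest_prodBernoulli`): `F_b ≥ 0`, `F_c ≥ 0` — prim-cert-1's CONJECTURE F `2u0u3 ≤ e·u3 + 3e·ubc + 2·min(uab,uac)·D` in its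
two-row form (`…APLConjF.lean`) —, Harris `e ≤ T·D` and APL-G `(TD − e)² ≤ uab·uac` (`e = uab+uac`, `D = μ(b ↮ c) = u0+e`, `T = μ(a↔b ∪ a↔c) = e+u3`;
all cells sum to `1`), hence also APL(2/3) `2TD ≤ 3e` (`apl23_of_geom`) and the quantitative Gladkov–Zimin Conjecture 6.3 (`gz63_of_geom`) on this
class (gen 29 COROLLARY B).  Transfer: `prodBernoulli_real_eq_PrW_univ` (cylinder laws), `PrW_univ_eq_support` (diagonal and weight-`0` pairs are
irrelevant), `SimpleGraph.isAcyclic_iff_forall_adj_isBridge` (acyclicity in the bridge form used by `conjF_forest`).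
[this work]
-/

namespace Summit.CriticalPhenomena.PercolationContinuityZ3.Theorems

namespace APL

open MeasureTheory Literature.Probability.Percolation Literature.Probability.Percolation.Gladkov
  Literature.Probability.Percolation.DecisionTree Literature.Probability.LatticeModels
open scoped Classical

variable {V : Type*} [Fintype V]

section Weights

variable {ι : Type*} [DecidableEq ι]

/-- Coordinates that either carry weight-`0` configurations or do not affect the event can be dropped from `PrW`. [folklore] -/
theorem PrW_union_irrelevant (p : ι → ℝ) {D L : Finset ι} (hdisj : Disjoint D L) (X : Set (Finset ι))
    (h : ∀ S₁, S₁ ⊆ D → ∀ S₂, S₂ ⊆ L → wtW L p S₂ = 0 ∨ (S₁ ∪ S₂ ∈ X ↔ S₁ ∈ X)) :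
    PrW (D ∪ L) p X = PrW D p X := by
  rw [PrW_glue_sum p hdisj X, PrW_eq_sum_ind]
  refine Finset.sum_congr rfl fun S₁ hS₁ => ?_
  rw [Finset.mem_powerset] at hS₁
  have key : ∀ S₂ ∈ L.powerset, wtW D p S₁ * wtW L p S₂ * ind X (S₁ ∪ S₂) = wtW D p S₁ * ind X S₁ * wtW L p S₂ := by
    intro S₂ hS₂
    rcases h S₁ hS₁ S₂ (Finset.mem_powerset.1 hS₂) with h0 | hiff
    · rw [h0]; ring
    · have : ind X (S₁ ∪ S₂) = ind X S₁ := by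
        by_cases hx : S₁ ∈ X
        · rw [ind_of_mem hx, ind_of_mem (hiff.2 hx)]
        · rw [ind_of_not_mem hx, ind_of_not_mem fun h' => hx (hiff.1 h')]
      rw [this]; ring
  rw [Finset.sum_congr rfl key, ← Finset.mul_sum, sum_wtW, mul_one]

end Weights

/-- Loops do not change clusters. [folklore] -/
theorem cl_union_diag (S T : Finset (Sym2 V)) (hT : ∀ e ∈ T, e.IsDiag) (x v : V) : v ∈ cl (S ∪ T) x ↔ v ∈ cl S x := by
  have hG : openGraph (↑(S ∪ T) : Set (Sym2 V)) = openGraph (↑S : Set (Sym2 V)) := by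
    ext u u'
    rw [adj_iff, adj_iff, Finset.mem_union]
    constructor
    · rintro ⟨h | h, hne⟩
      · exact ⟨h, hne⟩
      · exact absurd (Sym2.mk_isDiag_iff.1 (hT _ h)) hne
    · rintro ⟨h, hne⟩
      exact ⟨Or.inl h, hne⟩
  rw [mem_cl, mem_cl, hG]

/-- **Support reduction**: the `prodBernoulli w`-law of a cluster event (insensitive to loops) is the `PrW` over the positive-weight non-loop
pairs. [folklore] -/
theorem PrW_univ_eq_support (w : Sym2 V → unitInterval) (X : Set (Finset (Sym2 V)))
    (hX : ∀ S T : Finset (Sym2 V), (∀ e ∈ T, e.IsDiag) → (S ∪ T ∈ X ↔ S ∈ X)) :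
    PrW Finset.univ (fun e => (w e : ℝ)) X = PrW (Finset.univ.filter fun e : Sym2 V => ¬ e.IsDiag ∧ 0 < (w e : ℝ)) (fun e => (w e : ℝ)) X := by
  have hU : (Finset.univ.filter fun e : Sym2 V => ¬ e.IsDiag ∧ 0 < (w e : ℝ)) ∪ (Finset.univ.filter fun e : Sym2 V => ¬ (¬ e.IsDiag ∧ 0 < (w e : ℝ))) = Finset.univ :=
    Finset.filter_union_filter_not_eq (fun e : Sym2 V => ¬ e.IsDiag ∧ 0 < (w e : ℝ)) Finset.univ
  have key := PrW_union_irrelevant (fun e => (w e : ℝ)) (Finset.disjoint_filter_filter_not Finset.univ Finset.univ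
    (fun e : Sym2 V => ¬ e.IsDiag ∧ 0 < (w e : ℝ))) X ?_
  · rw [hU] at key
    exact key
  intro S₁ _ S₂ hS₂
  by_cases hdiag : ∀ e ∈ S₂, e.IsDiag
  · exact Or.inr (hX S₁ S₂ hdiag)
  · left
    push Not at hdiag
    obtain ⟨e, he, hne⟩ := hdiag
    have heL := hS₂ he
    have hw0 : (w e : ℝ) = 0 := by
      have h := (Finset.mem_filter.1 heL).2
      have h0 : 0 ≤ (w e : ℝ) := (w e).2.1
      by_contra hne0
      exact h ⟨hne, lt_of_le_of_ne h0 (Ne.symm hne0)⟩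
    exact wtW_eq_zero_of_mem _ he heL hw0

set_option maxHeartbeats 0 in
/-- **THEOREM F_T for bond percolation** (memo gen 34 §2, gen 36 §5; prim-cert-1's CONJECTURE F and gen 29's COROLLARY B on forests).
`μ = prodBernoulli w`, `a, b, c` distinct, the positive-weight non-loop pairs avoiding `b, c` form an acyclic graph.  Then the connection cells
of `(a; b, c)` satisfy `F_b ≥ 0`, `F_c ≥ 0`, Harris `eS ≤ TD` and APL-G `(TD − eS)² ≤ uab·uac·S²` (`S = 1` is the total mass, kept symbolic).
[this work] -/
theorem conjF_forest_prodBernoulli (w : Sym2 V → unitInterval) (a b c : V) (hab : a ≠ b) (hac : a ≠ c) (hbc : b ≠ c)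
    (hforest : (openGraph (↑((Finset.univ.filter fun e : Sym2 V => ¬ e.IsDiag ∧ 0 < (w e : ℝ)).filter fun f => b ∉ f ∧ c ∉ f) : Set (Sym2 V))).IsAcyclic) :
    0 ≤ 3*((prodBernoulli w).real (openConn a b ∩ (openConn a c)ᶜ)+(prodBernoulli w).real (openConn a c ∩ (openConn a b)ᶜ))*((prodBernoulli w).real ((openConn a b)ᶜ ∩ (openConn a c)ᶜ ∩ (openConn b c)ᶜ)+(prodBernoulli w).real (openConn a b ∩ (openConn a c)ᶜ)+(prodBernoulli w).real (openConn a c ∩ (openConn a b)ᶜ)+(prodBernoulli w).real ((openConn a b)ᶜ ∩ (openConn a c)ᶜ ∩ openConn b c)+(prodBernoulli w).real (openConn a b ∩ openConn a c)) - ((prodBernoulli w).real ((openConn a b)ᶜ ∩ (openConn a c)ᶜ ∩ (openConn b c)ᶜ)+(prodBernoulli w).real (openConn a b ∩ (openConn a c)ᶜ)+(prodBernoulli w).real (openConn a c ∩ (openConn a b)ᶜ))*((prodBernoulli w).real (openConn a b ∩ (openConn a c)ᶜ)+3*(prodBernoulli w).real (openConn a c ∩ (openConn a b)ᶜ)+2*(prodBernoulli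 w).real (openConn a b ∩ openConn a c))
      ∧ 0 ≤ 3*((prodBernoulli w).real (openConn a b ∩ (openConn a c)ᶜ)+(prodBernoulli w).real (openConn a c ∩ (openConn a b)ᶜ))*((prodBernoulli w).real ((openConn a b)ᶜ ∩ (openConn a c)ᶜ ∩ (openConn b c)ᶜ)+(prodBernoulli w).real (openConn a b ∩ (openConn a c)ᶜ)+(prodBernoulli w).real (openConn a c ∩ (openConn a b)ᶜ)+(prodBernoulli w).real ((openConn a b)ᶜ ∩ (openConn a c)ᶜ ∩ openConn b c)+(prodBernoulli w).real (openConn a b ∩ openConn a c)) - ((prodBernoulli w).real ((openConn a b)ᶜ ∩ (openConn a c)ᶜ ∩ (openConn b c)ᶜ)+(prodBernoulli w).real (openConn a b ∩ (openConn a c)ᶜ)+(prodBernoulli w).real (openConn a c ∩ (openConn a b)ᶜ))*(3*(prodBernoulli w).real (openConn a b ∩ (openConn a c)ᶜ)+(prodBernoulli w).real (openConn a c ∩ (openConn a b)ᶜ)+2*(prodBernoulli w).real (openConn a b ∩ openConn a c))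
      ∧ ((prodBernoulli w).real (openConn a b ∩ (openConn a c)ᶜ)+(prodBernoulli w).real (openConn a c ∩ (openConn a b)ᶜ))*((prodBernoulli w).real ((openConn a b)ᶜ ∩ (openConn a c)ᶜ ∩ (openConn b c)ᶜ)+(prodBernoulli w).real (openConn a b ∩ (openConn a c)ᶜ)+(prodBernoulli w).real (openConn a c ∩ (openConn a b)ᶜ)+(prodBernoulli w).real ((openConn a b)ᶜ ∩ (openConn a c)ᶜ ∩ openConn b c)+(prodBernoulli w).real (openConn a b ∩ openConn a c))
        ≤ ((prodBernoulli w).real (openConn a b ∩ (openConn a c)ᶜ)+(prodBernoulli w).real (openConn a c ∩ (openConn a b)ᶜ)+(prodBernoulli w).real (openConn a b ∩ openConn a c))*((prodBernoulli w).real ((openConn a b)ᶜ ∩ (openConn a c)ᶜ ∩ (openConn b c)ᶜ)+(prodBernoulli w).real (openConn a b ∩ (openConn a c)ᶜ)+(prodBernoulli w).real (openConn a c ∩ (openConn a b)ᶜ))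
      ∧ (((prodBernoulli w).real (openConn a b ∩ (openConn a c)ᶜ)+(prodBernoulli w).real (openConn a c ∩ (openConn a b)ᶜ)+(prodBernoulli w).real (openConn a b ∩ openConn a c))*((prodBernoulli w).real ((openConn a b)ᶜ ∩ (openConn a c)ᶜ ∩ (openConn b c)ᶜ)+(prodBernoulli w).real (openConn a b ∩ (openConn a c)ᶜ)+(prodBernoulli w).real (openConn a c ∩ (openConn a b)ᶜ)) - ((prodBernoulli w).real (openConn a b ∩ (openConn a c)ᶜ)+(prodBernoulli w).real (openConn a c ∩ (openConn a b)ᶜ))*((prodBernoulli w).real ((openConn a b)ᶜ ∩ (openConn a c)ᶜ ∩ (openConn b c)ᶜ)+(prodBernoulli w).real (openConn a b ∩ (openConn a c)ᶜ)+(prodBernoulli w).real (openConn a c ∩ (openConn a b)ᶜ)+(prodBernoulli w).real ((openConn a b)ᶜ ∩ (openConn a c)ᶜ ∩ openConn b c)+(prodBernoulli w).real (openConn a b ∩ openConn a c)))^2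
        ≤ (prodBernoulli w).real (openConn a b ∩ (openConn a c)ᶜ)*(prodBernoulli w).real (openConn a c ∩ (openConn a b)ᶜ)*((prodBernoulli w).real ((openConn a b)ᶜ ∩ (openConn a c)ᶜ ∩ (openConn b c)ᶜ)+(prodBernoulli w).real (openConn a b ∩ (openConn a c)ᶜ)+(prodBernoulli w).real (openConn a c ∩ (openConn a b)ᶜ)+(prodBernoulli w).real ((openConn a b)ᶜ ∩ (openConn a c)ᶜ ∩ openConn b c)+(prodBernoulli w).real (openConn a b ∩ openConn a c))^2 := by
  have hcl : ∀ (S : Finset (Sym2 V)) (u v : V), (↑S : Set (Sym2 V)) ∈ openConn u v ↔ v ∈ cl S u :=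
    fun S u v => by rw [mem_cl]; rfl
  have c_zero : (prodBernoulli w).real ((openConn a b)ᶜ ∩ (openConn a c)ᶜ ∩ (openConn b c)ᶜ)
      = PrW (Finset.univ.filter fun e : Sym2 V => ¬ e.IsDiag ∧ 0 < (w e : ℝ)) (fun e => (w e : ℝ)) {K : Finset (Sym2 V) | b ∉ cl K a ∧ c ∉ cl K a ∧ c ∉ cl K b} := by
    rw [prodBernoulli_real_eq_PrW_univ w (X := {K : Finset (Sym2 V) | b ∉ cl K a ∧ c ∉ cl K a ∧ c ∉ cl K b}) fun S => by
      simp only [Set.mem_setOf_eq, Set.mem_inter_iff, Set.mem_compl_iff, hcl, and_assoc]]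
    exact PrW_univ_eq_support w {K : Finset (Sym2 V) | b ∉ cl K a ∧ c ∉ cl K a ∧ c ∉ cl K b} fun S T hT => by
      simp only [Set.mem_setOf_eq, cl_union_diag S T hT]
  have c_ab : (prodBernoulli w).real (openConn a b ∩ (openConn a c)ᶜ)
      = PrW (Finset.univ.filter fun e : Sym2 V => ¬ e.IsDiag ∧ 0 < (w e : ℝ)) (fun e => (w e : ℝ)) {K : Finset (Sym2 V) | b ∈ cl K a ∧ c ∉ cl K a} := by
    rw [prodBernoulli_real_eq_PrW_univ w (X := {K : Finset (Sym2 V) | b ∈ cl K a ∧ c ∉ cl K a}) fun S => by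
      simp only [Set.mem_setOf_eq, Set.mem_inter_iff, Set.mem_compl_iff, hcl]]
    exact PrW_univ_eq_support w {K : Finset (Sym2 V) | b ∈ cl K a ∧ c ∉ cl K a} fun S T hT => by
      simp only [Set.mem_setOf_eq, cl_union_diag S T hT]
  have c_ac : (prodBernoulli w).real (openConn a c ∩ (openConn a b)ᶜ)
      = PrW (Finset.univ.filter fun e : Sym2 V => ¬ e.IsDiag ∧ 0 < (w e : ℝ)) (fun e => (w e : ℝ)) {K : Finset (Sym2 V) | c ∈ cl K a ∧ b ∉ cl K a} := by
    rw [prodBernoulli_real_eq_PrW_univ w (X := {K : Finset (Sym2 V) | c ∈ cl K a ∧ b ∉ cl K a}) fun S => by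
      simp only [Set.mem_setOf_eq, Set.mem_inter_iff, Set.mem_compl_iff, hcl]]
    exact PrW_univ_eq_support w {K : Finset (Sym2 V) | c ∈ cl K a ∧ b ∉ cl K a} fun S T hT => by
      simp only [Set.mem_setOf_eq, cl_union_diag S T hT]
  have c_bc : (prodBernoulli w).real ((openConn a b)ᶜ ∩ (openConn a c)ᶜ ∩ openConn b c)
      = PrW (Finset.univ.filter fun e : Sym2 V => ¬ e.IsDiag ∧ 0 < (w e : ℝ)) (fun e => (w e : ℝ)) {K : Finset (Sym2 V) | b ∉ cl K a ∧ c ∉ cl K a ∧ c ∈ cl K b} := by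
    rw [prodBernoulli_real_eq_PrW_univ w (X := {K : Finset (Sym2 V) | b ∉ cl K a ∧ c ∉ cl K a ∧ c ∈ cl K b}) fun S => by
      simp only [Set.mem_setOf_eq, Set.mem_inter_iff, Set.mem_compl_iff, hcl, and_assoc]]
    exact PrW_univ_eq_support w {K : Finset (Sym2 V) | b ∉ cl K a ∧ c ∉ cl K a ∧ c ∈ cl K b} fun S T hT => by
      simp only [Set.mem_setOf_eq, cl_union_diag S T hT]
  have c_three : (prodBernoulli w).real (openConn a b ∩ openConn a c)
      = PrW (Finset.univ.filter fun e : Sym2 V => ¬ e.IsDiag ∧ 0 < (w e : ℝ)) (fun e => (w e : ℝ)) {K : Finset (Sym2 V) | b ∈ cl K a ∧ c ∈ cl K a} := by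
    rw [prodBernoulli_real_eq_PrW_univ w (X := {K : Finset (Sym2 V) | b ∈ cl K a ∧ c ∈ cl K a}) fun S => by
      simp only [Set.mem_setOf_eq, Set.mem_inter_iff, hcl]]
    exact PrW_univ_eq_support w {K : Finset (Sym2 V) | b ∈ cl K a ∧ c ∈ cl K a} fun S T hT => by
      simp only [Set.mem_setOf_eq, cl_union_diag S T hT]
  rw [c_zero, c_ab, c_ac, c_bc, c_three]
  have hp0 : ∀ e, 0 ≤ (fun e => (w e : ℝ)) e := fun e => (w e).2.1
  have hp1 : ∀ e, (fun e => (w e : ℝ)) e ≤ 1 := fun e => (w e).2.2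
  refine conjF_forest hp0 hp1 b c hbc _ (Finset.univ.filter fun e : Sym2 V => ¬ e.IsDiag ∧ 0 < (w e : ℝ)) a rfl hab hac (fun f hf => (Finset.mem_filter.1 hf).2.1) ?_
  -- acyclicity in bridge form
  intro u v huv hbu hcu hreach
  have hne : u ≠ v := fun h => (Finset.mem_filter.1 huv).2.1 (Sym2.mk_isDiag_iff.2 h)
  have hadj : (openGraph (↑((Finset.univ.filter fun e : Sym2 V => ¬ e.IsDiag ∧ 0 < (w e : ℝ)).filter fun f => b ∉ f ∧ c ∉ f) : Set (Sym2 V))).Adj u v :=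
    adj_iff.2 ⟨Finset.mem_filter.2 ⟨huv, hbu, hcu⟩, hne⟩
  have hbr := SimpleGraph.isBridge_iff.1 (SimpleGraph.isAcyclic_iff_forall_adj_isBridge.1 hforest hadj)
  refine hbr (hreach.mono fun x y hxy => ?_)
  rw [SimpleGraph.deleteEdges_adj]
  obtain ⟨h1, h2⟩ := adj_iff.1 hxy
  exact ⟨adj_iff.2 ⟨(Finset.mem_erase.1 h1).2, h2⟩, by simpa using (Finset.mem_erase.1 h1).1⟩

end APL

end Summit.CriticalPhenomena.PercolationContinuityZ3.Theorems
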